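import Summits.AtomisticToContinuum.Crystallization.Theses.PricedLinkCensus
import Summits.AtomisticToContinuum.Crystallization.Theorems.ChargedEnergyGap.Negative.Unconditional
import Summits.AtomisticToContinuum.Crystallization.Theorems.PricedLinkCensusChargedEnergyGapRegularise
import Summits.AtomisticToContinuum.Crystallization.Theorems.PricedLinkCensusChargedEnergyGapChargeRecount
import Summits.AtomisticToContinuum.Crystallization.Theorems.PricedLinkCensusChargedEnergyGapEStarLe
import Summits.AtomisticToContinuum.Crystallization.Theorems.PricedLinkCensusChargedEnergyGapIsolatedSite
import Summits.AtomisticToContinuum.Crystallization.Theorems.PricedLinkCensusChargedEnergyGapSeparatedOfRegular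
import Summits.AtomisticToContinuum.Crystallization.Theorems.PricedLinkCensusChargedEnergyGapDeficitSplit
import Literature.MathematicalPhysics.StatisticalMechanics.BarlowStacking
import HarnessLib.Audit

/-!
# Line `two-tolerance-sandwich` — skeleton for crux `PricedLinkCensus.ChargedEnergyGap`
(item stmt-AtomisticToContinuum-14231, route route-AtomisticToContinuum-PricedLinkCensus) — lead c2's reshape

Crux (fixed, by name): `∃ κ > 0, ∃ C, ∀ N, ∀ injective y : Fin N → ℝ³,
N·e* + κ·#charged(1/100, y) − C·N^(2/3) ≤ E_LJ(y)`.

THE LINE (planner's card `Lines/two-tolerance-sandwich.md`).  Two tolerances: the crux tolerance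
`η₀ = 1/100` and a coarse PRICING tolerance `η_c = 3/100`.  On REGULAR configurations (hard core `1/3`,
no site farther than `16` from the rest — lead c2's normalisation, see RESHAPE) every `1 %`-charged site is
* COARSE   — charged at `3 %`: priced by `stub_coarseGap` (the `3/100` twin of the crux on regular
             configurations — the hardest stub, crux-like in kind, the line's open residue);
* SHALLOW  — charge-free at `3 %` but within `R·nn_i` of a coarse site: at most `(96R+1)³` of them per
             coarse site by hard-core packing (`shallowCount_le`, PROVED here);
* ISOLATED BAND — charge-free at `3 %` on its whole `R·nn_i`-window ("deep") but charged at `1 %`: the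
             perturbative species, CREDITED `c > 0` each by the deficit bound, which may DEBIT an O(1)
             constant per coarse and per shallow site.
`ChargedEnergyGap_of` (sorry-free): cover `#ch₁ ≤ #coarse + #shallow + #isoband`, the count, a WEIGHTED
average of the two lower bounds of the same excess, then the regularisation lifts regular → all injective `y`.

RESHAPE (lead c2, 2026-08-16).  (i) `stub_regularise` is no longer a stub: it is PROVED below from three
registered stubs — `stub_eStarLe` (`e* ≤ −1/4`, one shell of the unit cubic lattice), `stub_isolatedSite`
(a site with every other site at distance `≥ 16` in a `1/3`-separated configuration has site energy
`≥ −1/10`), `stub_separatedOfRegular` (isolated-site deletion: the priced gap on regular configurations gives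
it on all `1/3`-separated ones; margin `−e* − 1/10 ≥ 3/20` pays the `κ·F` recounted charges) — composed with
the LANDED closest-pair deletion `BarlowRelativePricingRegularise.stub_regularise` (p86708) and the LANDED
recount `BarlowRelativePricingRecount.stub_chargeRecount` (p85951, `F = 812`).  Hence the normalisation
hard core `1/3` (the tree's Lennard-Jones scale, `exists_le_siteEnergy_of_dist_lt`) and `nn ≤ 16` replaces
the card's `1/2` and `4`; the two priced stubs only get weaker hypotheses.  (ii) `stub_deficitBound` is split
into the provable restriction bookkeeping `stub_deficitSplit` (`E(y) ≥ ½ΣΣ_D V − B·#Dᶜ` for every index set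
`D` under the hard core — crude shell constant) and the perturbative `stub_deepCoercivity` (Cauchy–Born /
phonon coercivity of the deep sub-configuration, XL), and PROVED from them below.  (iii) Registered stub
signatures are fully inlined, fully qualified one-liners (a `Theorems/`-side `--supports` file restates them
textually); the readable `Goal.*` / `Regular` / `Deep` names are definitionally the inlined text.

STATUS (lead c2, end of wave 1, 2026-08-16): stubs A `stub_eStarLe` (p106667), B `stub_isolatedSite` (p105046),
C `stub_separatedOfRegular` (p106047), E `stub_deficitSplit` (p105000) LANDED under `Theorems/PricedLinkCensusChargedEnergyGap*.lean`
— hence `stub_regularise` is CLOSED; F `stub_deepCoercivity` came back `stub-blocked` and is RESHAPED into G `stub_softLayerThree`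
(soft layer propagation at 3/100, precision nn/5) + H `stub_barlowCoercivity` (uniform discrete LJ coercivity over Hägg words) with
F PROVED from them (`boundaryCount_le` packing); open: D `stub_coarseGap` (the crux at 3/100 on regular configurations — open
problem), G (L, geometry, the 3 % twin of route crux 14233), H (XL, contains a sharp lattice-energy inequality).  The line is
CLOSED MODULO {D, G, H}.

STATUS (lead c4, cycle 1, 2026-08-17): A, B, C, E are now DEFINED by their landed Theorems declarations (modules built on
the farm), so the file's only `sorry`s are D `stub_coarseGap`, G `stub_softLayerThree`, H `stub_barlowCoercivity`; lead c4
re-lands the Theorems-side glue `chargedEnergyGap_of_regular` (crux ⇔ crux on regular configurations; c2's p107724/p109211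
bounced only by a gate restart) and `chargedEnergyGap_of_coarse_of_softLayer_of_coercivity` (D → G → H → crux), waves G/H,
and holds D (the crux at tolerance 3/100 on regular configurations).

Disproof.lean (gen 3, "resists") honoured: tolerance `> 0` used quantitatively in both priced stubs
(`not_gapWith_of_eta_nonpos`); `C·N^(2/3)` kept but not relied on (`chargedEnergyGap_iff_noBoundary`);
injectivity kept (`not_gapNonInj`) and strengthened to the hard core `1/3`; both priced stubs are vacuous on
the ideal Barlow family exactly like the crux (`isChargeFree_barlowStacking`, `η < √2 − 1`).
-/

noncomputable section

namespace Summit.AtomisticToContinuum.Crystallization.Cruxes.ChargedEnergyGap.TwoToleranceSandwich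

open Literature.MathematicalPhysics.StatisticalMechanics
open Literature.Geometry.DiscreteGeometry
open Summit.AtomisticToContinuum.Crystallization.Theses.PricedLinkCensus
open Summit.AtomisticToContinuum.Crystallization.Theorems.ChargedEnergyGapNegative
  (E3 eStar charged GapWith chargedEnergyGap_iff excess_nonneg)
open Summit.AtomisticToContinuum.Crystallization.Theorems
open scoped BigOperators

/-! ## Objects of the line -/

/-- REGULAR configurations (lead c2's normalisation): hard core `1/3` and every site within distance `16`
of another site (`nn_i ≤ 16`).  The class to which the regularisation reduces the crux; it gives every
later step a uniform packing bound. -/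
def Regular {N : ℕ} (y : Fin N → E3) : Prop :=
  (∀ i j : Fin N, i ≠ j → (1 / 3 : ℝ) ≤ dist (y i) (y j)) ∧ ∀ i : Fin N, nearestDist y i ≤ 16

/-- Site `i` is DEEP at radius `R`: every site within `R · nn_i` of it (itself included) is
charge-free at the coarse tolerance `3/100`. -/
def Deep (R : ℝ) {N : ℕ} (y : Fin N → E3) (i : Fin N) : Prop :=
  ∀ j : Fin N, dist (y i) (y j) ≤ R * nearestDist y i → IsChargeFree (3 / 100 : ℝ) y j

/-- Number of SHALLOW sites: charge-free at `3/100` but not deep. -/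
def shallowCount (R : ℝ) {N : ℕ} (y : Fin N → E3) : ℕ :=
  Nat.card {i : Fin N // IsChargeFree (3 / 100 : ℝ) y i ∧ ¬ Deep R y i}

/-- Number of ISOLATED BAND sites: deep at radius `R` but charged at the crux tolerance `1/100`. -/
def isoBandCount (R : ℝ) {N : ℕ} (y : Fin N → E3) : ℕ :=
  Nat.card {i : Fin N // Deep R y i ∧ ¬ IsChargeFree (1 / 100 : ℝ) y i}

/-- Twice the Lennard-Jones energy of the sub-configuration indexed by `D` (ordered-pair sum). -/
def subEnergy2 {N : ℕ} (y : Fin N → E3) (D : Finset (Fin N)) : ℝ :=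
  ∑ i ∈ D, ∑ j ∈ D.erase i, lennardJones (dist (y i) (y j))

/-- A deep site is itself charge-free at `3/100` (take `j = i`). -/
theorem Deep.isChargeFree {R : ℝ} (hR : 0 ≤ R) {N : ℕ} {y : Fin N → E3} {i : Fin N}
    (h : Deep R y i) : IsChargeFree (3 / 100 : ℝ) y i :=
  h i (by rw [dist_self]; exact mul_nonneg hR (nearestDist_nonneg y i))

/-! ## The statements (namespace `Goal`; readable forms, definitionally the registered one-liners) -/

namespace Goal

/-- REGULARISATION (no longer a stub; proved below as `stub_regularise`).  The priced gap on REGULAR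
configurations implies the crux. -/
def stub_regularise : Prop :=
  (∃ κ C : ℝ, 0 < κ ∧ ∀ (N : ℕ) (y : Fin N → E3), Function.Injective y → Regular y →
      (N : ℝ) * eStar + κ * (charged (1 / 100) y : ℝ) - C * (N : ℝ) ^ (2 / 3 : ℝ) ≤
        interactionEnergy lennardJones y) →
    ChargedEnergyGap

/-- COARSE GAP (size: open-problem; the HARDEST stub, crux-like in kind).  The priced gap at the coarse
tolerance `3/100` on regular configurations. -/
def stub_coarseGap : Prop :=
  ∃ κ C : ℝ, 0 < κ ∧ ∀ (N : ℕ) (y : Fin N → E3), Function.Injective y → Regular y →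
    (N : ℝ) * eStar + κ * (charged (3 / 100) y : ℝ) - C * (N : ℝ) ^ (2 / 3 : ℝ) ≤
      interactionEnergy lennardJones y

/-- DEFICIT BOUND FOR THE ISOLATED BAND (no longer a stub; proved below from `stub_deficitSplit` and
`stub_deepCoercivity`). -/
def stub_deficitBound : Prop :=
  ∃ R c C' C : ℝ, 1 ≤ R ∧ 0 < c ∧ 0 ≤ C' ∧
    ∀ (N : ℕ) (y : Fin N → E3), Function.Injective y → Regular y →
      c * (isoBandCount R y : ℝ) - C' * ((charged (3 / 100) y : ℝ) + (shallowCount R y : ℝ)) -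
          C * (N : ℝ) ^ (2 / 3 : ℝ) ≤
        interactionEnergy lennardJones y - (N : ℝ) * eStar

end Goal

/-! ## Registered stubs (signatures fully inlined and qualified, one line each; A, B, C, E are CLOSED by their landed
Theorems declarations — the ONLY `sorry`s of the file are D, G, H) -/

/-- **STUB A — `e* ≤ −1/4`** (S; LANDED p106667, `TwoToleranceSandwichEStar.stub_eStarLe`).  The Bravais configuration of the unit cubic lattice
(`bravaisConfiguration (cubicLattice 1)`, motif `{0}`) has six points at distance `1` from `0`
(`V_LJ(1) = −1/12`) and all other points at distance `≥ 1` (`V_LJ ≤ 0`, `lennardJones_nonpos`); its lattice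
sum is summable (`summable_lennardJones_dist_three`), so `e(ℤ³) ≤ ½·6·(−1/12) = −1/4`, and `e* ≤ e(ℤ³)`
(`ChargedEnergyGapNegative.eStar_le`). -/
theorem stub_eStarLe : Summit.AtomisticToContinuum.Crystallization.Theorems.ChargedEnergyGapNegative.eStar ≤ -(1 / 4 : ℝ) :=
  -- LANDED p106667: `Theorems/PricedLinkCensusChargedEnergyGapEStarLe.lean` (CLOSED, defined by the landed decl).
  TwoToleranceSandwichEStar.stub_eStarLe

/-- **STUB B — isolated sites are energetically cheap to delete** (M; LANDED p105046, `TwoToleranceSandwichIsolatedSite.stub_isolatedSite`).  In a `1/3`-separated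
configuration a site all of whose distances to the other sites are `≥ 16` has Lennard-Jones site energy
`≥ −1/10`: `V_LJ(d) ≥ −d⁻⁶/6`; the sites with `⌊d⌋ = b` (`b ≥ 16`) number at most `(6(b+1)+1)³ ≤ 267·b³`
(`card_le_of_separated_of_dist_le`), contribute `≤ 267·b⁻³ ≤ 267/((b−1)b(b+1))`, and the telescoping sum
from `b = 16` is `≤ 267/480 < 3/5`; divide by `6`. -/
theorem stub_isolatedSite : ∀ (N : ℕ) (y : Fin N → EuclideanSpace ℝ (Fin 3)) (i : Fin N), (∀ j k : Fin N, j ≠ k → (1 / 3 : ℝ) ≤ dist (y j) (y k)) → (∀ j : Fin N, j ≠ i → (16 : ℝ) ≤ dist (y i) (y j)) → -(1 / 10 : ℝ) ≤ Literature.MathematicalPhysics.StatisticalMechanics.siteEnergy Literature.MathematicalPhysics.StatisticalMechanics.lennardJones y i :=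
  -- LANDED p105046: `Theorems/PricedLinkCensusChargedEnergyGapIsolatedSite.lean` (CLOSED, defined by the landed decl).
  TwoToleranceSandwichIsolatedSite.stub_isolatedSite

/-- **STUB C — regular ⇒ separated** (M; LANDED p106047, `TwoToleranceSandwichSeparated.stub_separatedOfRegular`; pattern: the landed
`BarlowRelativePricingRegularise.stub_regularise`).  Given the priced gap on regular configurations, `e* ≤ −1/4`
(stub A), the isolated-site bound (stub B) and the recount bound under deletion of one particle (landed
`BarlowRelativePricingRecount.stub_chargeRecount`), the priced gap holds on all `1/3`-separated configurations
with `κ' = min κ ((3/20)/(F+1))`, `C' = max C 0`: induction on `N`; a separated configuration with all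
`nn ≤ 16` is regular; otherwise delete a site `i₀` with `nn_{i₀} > 16` — `E(y) = E(y ∘ i₀.succAbove) + (≥ −1/10)`
(`interactionEnergy_eq_succAbove_add_siteEnergy`), the remaining configuration is still separated, the `≤ F` recounted
charges cost `κ'·F ≤ 3/20`, and `e* + 3/20 ≤ −1/10`. -/
theorem stub_separatedOfRegular : (∃ κ C : ℝ, 0 < κ ∧ ∀ (N : ℕ) (y : Fin N → EuclideanSpace ℝ (Fin 3)), Function.Injective y → ((∀ i j : Fin N, i ≠ j → (1 / 3 : ℝ) ≤ dist (y i) (y j)) ∧ ∀ i : Fin N, Literature.Geometry.DiscreteGeometry.nearestDist y i ≤ 16) → (N : ℝ) * Summit.AtomisticToContinuum.Crystallization.Theorems.ChargedEnergyGapNegative.eStar + κ * (Nat.card {i : Fin N // ¬ Literature.Geometry.DiscreteGeometry.IsChargeFree (1 / 100 : ℝ) y i} : ℝ) - C * (N : ℝ) ^ (2 / 3 : ℝ) ≤ Literature.MathematicalPhysics.StatisticalMechanics.interactionEnergy Literature.MathematicalPhysics.StatisticalMechanics.lennardJones y) → Summit.AtomisticToContinuum.Crystallization.Theorems.ChargedEnergyGapNegative.eStar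 ≤ -(1 / 4 : ℝ) → (∀ (N : ℕ) (y : Fin N → EuclideanSpace ℝ (Fin 3)) (i : Fin N), (∀ j k : Fin N, j ≠ k → (1 / 3 : ℝ) ≤ dist (y j) (y k)) → (∀ j : Fin N, j ≠ i → (16 : ℝ) ≤ dist (y i) (y j)) → -(1 / 10 : ℝ) ≤ Literature.MathematicalPhysics.StatisticalMechanics.siteEnergy Literature.MathematicalPhysics.StatisticalMechanics.lennardJones y i) → (∃ F : ℕ, ∀ (N : ℕ) (x : Fin (N + 1) → EuclideanSpace ℝ (Fin 3)) (i₀ : Fin (N + 1)), Function.Injective x → Nat.card {i : Fin (N + 1) // ¬ Literature.Geometry.DiscreteGeometry.IsChargeFree (1 / 100 : ℝ) x i} ≤ Nat.card {i : Fin N // ¬ Literature.Geometry.DiscreteGeometry.IsChargeFree (1 / 100 : ℝ) (x ∘ Fin.succAbove i₀) i} + F) → ∃ κ : ℝ, 0 < κ ∧ ∃ C : ℝ, ∀ (N : ℕ) (y : Fin N → EuclideanSpace ℝ (Fin 3)), (∀ i j : Fin N, i ≠ j → (1 / 3 : ℝ) ≤ dist (y i) (y j)) → (N : ℝ) * Summit.AtomisticToContinuum.Crystallization.Theorems.ChargedEnergyGapNegative.eStar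 + κ * (Nat.card {i : Fin N // ¬ Literature.Geometry.DiscreteGeometry.IsChargeFree (1 / 100 : ℝ) y i} : ℝ) - C * (N : ℝ) ^ (2 / 3 : ℝ) ≤ Literature.MathematicalPhysics.StatisticalMechanics.interactionEnergy Literature.MathematicalPhysics.StatisticalMechanics.lennardJones y :=
  -- LANDED p106047: `Theorems/PricedLinkCensusChargedEnergyGapSeparatedOfRegular.lean` (CLOSED, defined by the landed decl).
  TwoToleranceSandwichSeparated.stub_separatedOfRegular

/-- **STUB D — COARSE GAP at `3/100` on regular configurations** (open-problem size; THE HARDEST, the lead's;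
see `Goal.stub_coarseGap`).  It is the crux's `3/100` twin restricted to regular configurations and carries the
crux's open content (`0 < κ_max` in the language of Negative VIII); why it might fail: exactly as the crux — a
non-close-packed periodic near-minimiser of `e_LJ` (`kill_forall_charged_near` at tolerance `3/100`). -/
theorem stub_coarseGap : ∃ κ C : ℝ, 0 < κ ∧ ∀ (N : ℕ) (y : Fin N → EuclideanSpace ℝ (Fin 3)), Function.Injective y → ((∀ i j : Fin N, i ≠ j → (1 / 3 : ℝ) ≤ dist (y i) (y j)) ∧ ∀ i : Fin N, Literature.Geometry.DiscreteGeometry.nearestDist y i ≤ 16) → (N : ℝ) * Summit.AtomisticToContinuum.Crystallization.Theorems.ChargedEnergyGapNegative.eStar + κ * (Nat.card {i : Fin N // ¬ Literature.Geometry.DiscreteGeometry.IsChargeFree (3 / 100 : ℝ) y i} : ℝ) - C * (N : ℝ) ^ (2 / 3 : ℝ) ≤ Literature.MathematicalPhysics.StatisticalMechanics.interactionEnergy Literature.MathematicalPhysics.StatisticalMechanics.lennardJones y := by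
  sorry

/-- **STUB E — restriction bookkeeping under the hard core** (M; LANDED p105000, `TwoToleranceSandwichDeficitSplit.stub_deficitSplit`, witness `B = 3·30375/2`).  For a `1/3`-separated
configuration and ANY index set `D`, the energy of `y` is at least half the ordered-pair sum over `D` minus an
absolute constant per site outside `D`: every ordered pair not inside `D × D` contains a site of `Dᶜ`, and the
total attraction seen by one site of a `1/3`-separated configuration is at most `(1/6)·250·3⁶` (`V_LJ(d) ≥ −d⁻⁶/6`,
`sum_inv_pow_six_le`), so `B = 2·(250·729/6)` works (`two_mul_interactionEnergy`, `siteEnergy`). -/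
theorem stub_deficitSplit : ∃ B : ℝ, ∀ (N : ℕ) (y : Fin N → EuclideanSpace ℝ (Fin 3)), (∀ i j : Fin N, i ≠ j → (1 / 3 : ℝ) ≤ dist (y i) (y j)) → ∀ D : Finset (Fin N), (1 / 2 : ℝ) * (∑ i ∈ D, ∑ j ∈ D.erase i, Literature.MathematicalPhysics.StatisticalMechanics.lennardJones (dist (y i) (y j))) - B * ((N : ℝ) - (D.card : ℝ)) ≤ Literature.MathematicalPhysics.StatisticalMechanics.interactionEnergy Literature.MathematicalPhysics.StatisticalMechanics.lennardJones y :=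
  -- LANDED p105000: `Theorems/PricedLinkCensusChargedEnergyGapDeficitSplit.lean` (CLOSED, defined by the landed decl).
  TwoToleranceSandwichDeficitSplit.stub_deficitSplit

/-- Site `i` carries a BARLOW CHART at tolerance-3 % precision: a rigid image of an ideal Barlow stacking of spacing
`nn_i` (any Hägg word) two-way `nn_i/5`-matches the configuration on the `3·nn_i`-ball (the conclusion of stub G). -/
def Chart {N : ℕ} (y : Fin N → E3) (i : Fin N) : Prop :=
  ∃ (s : ℤ → ℤ) (g : EuclideanSpace ℝ (Fin 3) ≃ᵃⁱ[ℝ] EuclideanSpace ℝ (Fin 3)), IsHaggSeq s ∧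
    (∀ j : Fin N, dist (y i) (y j) ≤ 3 * nearestDist y i →
      ∃ z ∈ barlowStacking (nearestDist y i) (nearestDist y i * Real.sqrt (2 / 3)) s,
        dist (y j) (g z) ≤ nearestDist y i / 5) ∧
    ∀ z ∈ barlowStacking (nearestDist y i) (nearestDist y i * Real.sqrt (2 / 3)) s,
      dist (y i) (g z) ≤ 3 * nearestDist y i → ∃ j : Fin N, dist (y j) (g z) ≤ nearestDist y i / 5

/-- **STUB G — SOFT LAYER PROPAGATION AT `3/100`** (L, pure metric geometry; the first missing input of the deep
coercivity, wave-1 worker analysis `stub_deepCoercivity-analysis.md` §4).  If every site within `8·nn_i` of `y_i` is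
charge-free at tolerance `3/100`, the configuration within `3·nn_i` of `y_i` is two-way `(nn_i/5)`-matched to a rigid image
of an ideal Barlow stacking of spacing `nn_i` (any Hägg word).  It is the `η = 3/100` companion of the route crux
`PricedLinkCensus.SoftLayerPropagation` (stmt-AtomisticToContinuum-14233, stated for `η ≤ 1/100` at precision `nn/6`); the
precision is loosened to `nn/5` because the verbatim `nn/6` copy is SATURATED at `3 %` ([001]-stretched fcc at `s = 5.915 %`:
chart error `2√2·s·nn = 0.1673·nn > nn/6`), and `nn/5 < nn/2` still makes the labelling unique.  Why it might fail: the
`3 %` jitterbug twist (17°, displacement 0.145·nn per shell); an everywhere-12/4-ring non-Barlow window at `3 %` (none known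
below the 5.15 % icosahedral closure; 13-coordinated sites are charged, hence excluded by hypothesis). -/
theorem stub_softLayerThree : ∀ (N : ℕ) (y : Fin N → EuclideanSpace ℝ (Fin 3)) (i : Fin N), (∀ j : Fin N, dist (y i) (y j) ≤ 8 * Literature.Geometry.DiscreteGeometry.nearestDist y i → Literature.Geometry.DiscreteGeometry.IsChargeFree (3 / 100 : ℝ) y j) → ∃ (s : ℤ → ℤ) (g : EuclideanSpace ℝ (Fin 3) ≃ᵃⁱ[ℝ] EuclideanSpace ℝ (Fin 3)), Literature.MathematicalPhysics.StatisticalMechanics.IsHaggSeq s ∧ (∀ j : Fin N, dist (y i) (y j) ≤ 3 * Literature.Geometry.DiscreteGeometry.nearestDist y i → ∃ z ∈ Literature.MathematicalPhysics.StatisticalMechanics.barlowStacking (Literature.Geometry.DiscreteGeometry.nearestDist y i) (Literature.Geometry.DiscreteGeometry.nearestDist y i * Real.sqrt (2 / 3)) s, dist (y j) (g z) ≤ Literature.Geometry.DiscreteGeometry.nearestDist y i / 5) ∧ ∀ z ∈ Literature.MathematicalPhysics.StatisticalMechanics.barlowStacking (Literature.Geometry.DiscreteGeometry.nearestDist y i)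 (Literature.Geometry.DiscreteGeometry.nearestDist y i * Real.sqrt (2 / 3)) s, dist (y i) (g z) ≤ 3 * Literature.Geometry.DiscreteGeometry.nearestDist y i → ∃ j : Fin N, dist (y j) (g z) ≤ Literature.Geometry.DiscreteGeometry.nearestDist y i / 5 := by
  sorry

/-- **STUB H — UNIFORM BARLOW COERCIVITY** (XL, discrete nonlinear elasticity; the second missing input, analysis §5).  On
`1/3`-separated configurations with `nn ≤ 16`, for every index set `W` all of whose sites carry a Barlow chart (stub G's
conclusion) and an `8·nn`-window clean at `3 %`, the excess `½ΣΣ_W V − #W·e*` of the sub-configuration pays `c > 0` per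
`4·nn`-INTERIOR site of `W` that is charged at `1/100`, up to a debit `C'` per site of `W` with a non-`W` site within `4·nn`.
Intended proof: relative to `e_B = ⨅` periodic Barlow energies (`≥ e*` for free, `ChargedEnergyGapNegative.eStar_le`):
discrete Cauchy–Born / phonon coercivity of Lennard-Jones UNIFORMLY over Hägg words and scales `a ∈ [1/3, 16]` for bond
strains `≤ 6 %` — a `1 %`-charged, `3 %`-clean site has two contact bonds of length ratio `> 1.01` in its star, i.e. a
distortion `≥ 0.5 %·a` from every similarity copy of the chart, harmonic credit `≥ ½λ_min(0.005a)²` shared by `≤ 55` sites;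
first-order (reference-force) terms are null Lagrangians telescoping to the `4·nn`-boundary of `W` (the debit).  It CONTAINS
the sharp lattice inequality "every homogeneous `3 %`-clean `1 %`-charged Barlow crystal lies `≥ c` per site above `e_Bmin`"
(witness scale: [001]-stretched fcc at `s = 2 %`, volume-relaxed, sits `4.3·10⁻⁴` above `e_fcc`; so `c ≲ 4·10⁻⁴`).  Cousins,
all open: `PhononSlackCertificates.NearFieldConvexity` (13958), `ExcessDecayLiouville.PhononStability` (9333),
barlow-relative-pricing's `stub_perturbativePeriodic` (whose rigid `nn/40` charts do NOT cover this species). -/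
theorem stub_barlowCoercivity : ∃ c : ℝ, 0 < c ∧ ∃ C' : ℝ, ∀ (N : ℕ) (y : Fin N → EuclideanSpace ℝ (Fin 3)), (∀ i j : Fin N, i ≠ j → (1 / 3 : ℝ) ≤ dist (y i) (y j)) → (∀ i : Fin N, Literature.Geometry.DiscreteGeometry.nearestDist y i ≤ 16) → ∀ W : Finset (Fin N), (∀ i ∈ W, (∃ (s : ℤ → ℤ) (g : EuclideanSpace ℝ (Fin 3) ≃ᵃⁱ[ℝ] EuclideanSpace ℝ (Fin 3)), Literature.MathematicalPhysics.StatisticalMechanics.IsHaggSeq s ∧ (∀ j : Fin N, dist (y i) (y j) ≤ 3 * Literature.Geometry.DiscreteGeometry.nearestDist y i → ∃ z ∈ Literature.MathematicalPhysics.StatisticalMechanics.barlowStacking (Literature.Geometry.DiscreteGeometry.nearestDist y i) (Literature.Geometry.DiscreteGeometry.nearestDist y i * Real.sqrt (2 / 3)) s, dist (y j) (g z) ≤ Literature.Geometry.DiscreteGeometry.nearestDist y i / 5) ∧ ∀ z ∈ Literature.MathematicalPhysics.StatisticalMechanics.barlowStacking (Literature.Geometry.DiscreteGeometry.nearestDist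 y i) (Literature.Geometry.DiscreteGeometry.nearestDist y i * Real.sqrt (2 / 3)) s, dist (y i) (g z) ≤ 3 * Literature.Geometry.DiscreteGeometry.nearestDist y i → ∃ j : Fin N, dist (y j) (g z) ≤ Literature.Geometry.DiscreteGeometry.nearestDist y i / 5) ∧ ∀ j : Fin N, dist (y i) (y j) ≤ 8 * Literature.Geometry.DiscreteGeometry.nearestDist y i → Literature.Geometry.DiscreteGeometry.IsChargeFree (3 / 100 : ℝ) y j) → c * (Nat.card {i : Fin N // i ∈ W ∧ (∀ j : Fin N, dist (y i) (y j) ≤ 4 * Literature.Geometry.DiscreteGeometry.nearestDist y i → j ∈ W) ∧ ¬ Literature.Geometry.DiscreteGeometry.IsChargeFree (1 / 100 : ℝ) y i} : ℝ) - C' * (Nat.card {i : Fin N // i ∈ W ∧ ∃ j : Fin N, j ∉ W ∧ dist (y i) (y j) ≤ 4 * Literature.Geometry.DiscreteGeometry.nearestDist y i} : ℝ) ≤ (1 / 2 : ℝ) * (∑ i ∈ W, ∑ j ∈ W.erase i, Literature.MathematicalPhysics.StatisticalMechanics.lennardJones (dist (y i) (y j))) - (W.card : ℝ) * Summit.AtomisticToContinuum.Crystallization.Theorems.ChargedEnergyGapNegative.eStar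 := by
  sorry

/-! ### Consistency: each readable statement IS its registered stub (definitionally) -/

theorem coarseGap_holds : Goal.stub_coarseGap := stub_coarseGap

theorem softLayerThree_holds : ∀ (N : ℕ) (y : Fin N → E3) (i : Fin N),
    (∀ j : Fin N, dist (y i) (y j) ≤ 8 * nearestDist y i → IsChargeFree (3 / 100 : ℝ) y j) → Chart y i :=
  stub_softLayerThree

theorem barlowCoercivity_holds : ∃ c : ℝ, 0 < c ∧ ∃ C' : ℝ, ∀ (N : ℕ) (y : Fin N → E3),
    (∀ i j : Fin N, i ≠ j → (1 / 3 : ℝ) ≤ dist (y i) (y j)) → (∀ i : Fin N, nearestDist y i ≤ 16) →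
      ∀ W : Finset (Fin N), (∀ i ∈ W, Chart y i ∧ Deep 8 y i) →
        c * (Nat.card {i : Fin N // i ∈ W ∧ (∀ j : Fin N, dist (y i) (y j) ≤ 4 * nearestDist y i → j ∈ W) ∧
            ¬ IsChargeFree (1 / 100 : ℝ) y i} : ℝ) -
          C' * (Nat.card {i : Fin N // i ∈ W ∧ ∃ j : Fin N, j ∉ W ∧ dist (y i) (y j) ≤ 4 * nearestDist y i} : ℝ) ≤
        (1 / 2 : ℝ) * subEnergy2 y W - (W.card : ℝ) * eStar :=
  stub_barlowCoercivity

theorem deficitSplit_holds : ∃ B : ℝ, ∀ (N : ℕ) (y : Fin N → E3),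
    (∀ i j : Fin N, i ≠ j → (1 / 3 : ℝ) ≤ dist (y i) (y j)) → ∀ D : Finset (Fin N),
      (1 / 2 : ℝ) * subEnergy2 y D - B * ((N : ℝ) - (D.card : ℝ)) ≤ interactionEnergy lennardJones y :=
  stub_deficitSplit

/-! ## The regularisation, PROVED from stubs A–C and the landed deletion files (no `sorry` below this line) -/

/-- The priced gap on REGULAR configurations implies the crux: stubs A–C give it on all `1/3`-separated
configurations, the landed `BarlowRelativePricingRegularise.stub_regularise` (closest-pair deletion below `1/3`,
with the landed recount `BarlowRelativePricingRecount.stub_chargeRecount`) on all injective ones, and that is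
`ChargedEnergyGap` verbatim (`e*`, `#charged` unfold by `rfl`). -/
theorem stub_regularise : Goal.stub_regularise := by
  intro h
  have hsep := stub_separatedOfRegular h stub_eStarLe stub_isolatedSite
    BarlowRelativePricingRecount.stub_chargeRecount
  obtain ⟨κ, hκ, C, hall⟩ := BarlowRelativePricingRegularise.stub_regularise
    BarlowRelativePricingRecount.stub_chargeRecount eStar hsep
  exact ⟨κ, C, hκ, hall⟩

/-! ## Sanity (sorry-free): where the stubs sit relative to the crux -/

/-- The coarse stub is implied by the `3/100` twin of the crux (so it is the weaker statement). -/
theorem coarseGap_of_gapWith {κ C : ℝ} (hκ : 0 < κ) (h : GapWith (3 / 100) κ C) :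
    Goal.stub_coarseGap :=
  ⟨κ, C, hκ, fun N y hy _ => h N y hy⟩

/-- The hypothesis of the regularisation is implied by the crux (drop `Regular`): the crux is EQUIVALENT to
its restriction to regular configurations. -/
theorem regularGap_of_chargedEnergyGap (h : ChargedEnergyGap) :
    ∃ κ C : ℝ, 0 < κ ∧ ∀ (N : ℕ) (y : Fin N → E3), Function.Injective y → Regular y →
      (N : ℝ) * eStar + κ * (charged (1 / 100) y : ℝ) - C * (N : ℝ) ^ (2 / 3 : ℝ) ≤
        interactionEnergy lennardJones y := by
  obtain ⟨κ, C, hκ, hgap⟩ := (chargedEnergyGap_iff).1 h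
  exact ⟨κ, C, hκ, fun N y hy _ => hgap N y hy⟩

/-- The crux restricted to regular configurations IS the crux. -/
theorem chargedEnergyGap_iff_regular :
    ChargedEnergyGap ↔ ∃ κ C : ℝ, 0 < κ ∧ ∀ (N : ℕ) (y : Fin N → E3), Function.Injective y → Regular y →
      (N : ℝ) * eStar + κ * (charged (1 / 100) y : ℝ) - C * (N : ℝ) ^ (2 / 3 : ℝ) ≤
        interactionEnergy lennardJones y :=
  ⟨regularGap_of_chargedEnergyGap, stub_regularise⟩

/-- CHARGE MONOTONICITY (pure geometry, UNPROVED, not a stub: needed only for the converse direction). -/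
def ChargeMonotone : Prop :=
  ∀ (N : ℕ) (y : Fin N → E3) (i : Fin N),
    IsChargeFree (1 / 100 : ℝ) y i → IsChargeFree (3 / 100 : ℝ) y i

/-- Monotonicity of a finite subtype count. -/
theorem natCard_subtype_mono {α : Type*} [Finite α] {p q : α → Prop} (h : ∀ a, p a → q a) :
    Nat.card {a // p a} ≤ Nat.card {a // q a} := by
  classical
  haveI := Fintype.ofFinite α
  simp only [Nat.card_eq_fintype_card, Fintype.card_subtype]
  exact Finset.card_le_card fun a ha => by
    simp only [Finset.mem_filter, Finset.mem_univ, true_and] at ha ⊢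
    exact h a ha

/-- Given charge monotonicity the crux implies the coarse stub (same `κ`, `C`). -/
theorem coarseGap_of_chargedEnergyGap (hm : ChargeMonotone) (h : ChargedEnergyGap) :
    Goal.stub_coarseGap := by
  obtain ⟨κ, C, hκ, hgap⟩ := (chargedEnergyGap_iff).1 h
  refine ⟨κ, C, hκ, fun N y hy _ => ?_⟩
  have hmono : (charged (3 / 100) y : ℝ) ≤ (charged (1 / 100) y : ℝ) := by
    unfold charged
    exact_mod_cast natCard_subtype_mono (p := fun i => ¬ IsChargeFree (3 / 100 : ℝ) y i)
      (q := fun i => ¬ IsChargeFree (1 / 100 : ℝ) y i) (fun i hi h1 => hi (hm N y i h1))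
  have := mul_le_mul_of_nonneg_left hmono hκ.le
  linarith [hgap N y hy]

/-! ## The deficit bound, PROVED from stubs A, E, F (bookkeeping) -/

/-- Three-way cover of a finite subtype count. -/
theorem natCard_le_add_three {α : Type*} [Finite α] {p q r s : α → Prop}
    (h : ∀ a, p a → q a ∨ r a ∨ s a) :
    Nat.card {a // p a} ≤ Nat.card {a // q a} + Nat.card {a // r a} + Nat.card {a // s a} := by
  classical
  haveI := Fintype.ofFinite α
  simp only [Nat.card_eq_fintype_card, Fintype.card_subtype]
  calc (Finset.univ.filter p).card
      ≤ ((Finset.univ.filter q ∪ Finset.univ.filter r) ∪ Finset.univ.filter s).card := by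
        apply Finset.card_le_card
        intro a ha
        simp only [Finset.mem_filter, Finset.mem_univ, true_and, Finset.mem_union] at ha ⊢
        rcases h a ha with h1 | h2 | h3
        · exact Or.inl (Or.inl h1)
        · exact Or.inl (Or.inr h2)
        · exact Or.inr h3
    _ ≤ (Finset.univ.filter q ∪ Finset.univ.filter r).card + (Finset.univ.filter s).card :=
        Finset.card_union_le _ _
    _ ≤ (Finset.univ.filter q).card + (Finset.univ.filter r).card + (Finset.univ.filter s).card := by
        have := Finset.card_union_le (Finset.univ.filter q) (Finset.univ.filter r)
        omega


/-- Additivity of a finite subtype count over a predicate and its negation. -/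
theorem natCard_subtype_add_not {α : Type*} [Finite α] (p q : α → Prop) :
    Nat.card {a // p a} = Nat.card {a // p a ∧ q a} + Nat.card {a // p a ∧ ¬ q a} := by
  classical
  haveI := Fintype.ofFinite α
  simp only [Nat.card_eq_fintype_card, Fintype.card_subtype]
  rw [← Finset.card_union_of_disjoint]
  · congr 1
    ext a
    simp only [Finset.mem_filter, Finset.mem_univ, true_and, Finset.mem_union]
    tauto
  · exact Finset.disjoint_left.2 fun a ha hb => by
      simp only [Finset.mem_filter, Finset.mem_univ, true_and] at ha hb
      exact hb.2 ha.2

/-- The non-deep sites are exactly the coarse plus the shallow ones (`R ≥ 0`). -/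
theorem card_not_deep {R : ℝ} (hR : 0 ≤ R) {N : ℕ} (y : Fin N → E3) :
    (Nat.card {i : Fin N // ¬ Deep R y i} : ℝ) = (charged (3 / 100) y : ℝ) + (shallowCount R y : ℝ) := by
  have h1 := natCard_subtype_add_not (fun i : Fin N => ¬ Deep R y i)
    (fun i => IsChargeFree (3 / 100 : ℝ) y i)
  have h2 : Nat.card {i : Fin N // ¬ Deep R y i ∧ IsChargeFree (3 / 100 : ℝ) y i} = shallowCount R y := by
    unfold shallowCount
    exact Nat.card_congr (Equiv.subtypeEquivRight fun i => by tauto)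
  have h3 : Nat.card {i : Fin N // ¬ Deep R y i ∧ ¬ IsChargeFree (3 / 100 : ℝ) y i} = charged (3 / 100) y := by
    unfold charged
    exact Nat.card_congr (Equiv.subtypeEquivRight fun i =>
      ⟨fun h => h.2, fun h => ⟨fun hd => h (hd.isChargeFree hR), h⟩⟩)
  rw [h1, h2, h3]
  push_cast
  ring

/-- `N = #deep + #non-deep`, with the deep sites as a `Finset`. -/
theorem card_deep_add {R : ℝ} {N : ℕ} (y : Fin N → E3) (D : Finset (Fin N))
    (hD : ∀ i : Fin N, i ∈ D ↔ Deep R y i) :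
    (N : ℝ) = (D.card : ℝ) + (Nat.card {i : Fin N // ¬ Deep R y i} : ℝ) := by
  classical
  have h1 : Nat.card {i : Fin N // ¬ Deep R y i} = (Finset.univ.filter fun i : Fin N => ¬ Deep R y i).card := by
    rw [Nat.card_eq_fintype_card, Fintype.card_subtype]
  have h2 : D = Finset.univ.filter fun i : Fin N => Deep R y i := by
    ext i; simp [hD i]
  have h3 := Finset.card_filter_add_card_filter_not (s := (Finset.univ : Finset (Fin N)))
    (fun i : Fin N => Deep R y i)
  rw [Finset.card_univ, Fintype.card_fin] at h3
  rw [h1, h2]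
  exact_mod_cast h3.symm

/-- BOUNDARY DEEP SITES ARE FEW: on regular configurations the sites of `D` having a non-`D` site within `4·nn_i ≤ 64`
number at most `385³` times the non-`D` sites (packing, `card_le_of_separated_of_dist_le`, as in `shallowCount_le`). -/
theorem boundaryCount_le {N : ℕ} {y : Fin N → E3} (hy : Function.Injective y) (hreg : Regular y)
    (D : Finset (Fin N)) :
    (Nat.card {i : Fin N // i ∈ D ∧ ∃ j : Fin N, j ∉ D ∧ dist (y i) (y j) ≤ 4 * nearestDist y i} : ℝ) ≤
      (385 : ℝ) ^ 3 * (Nat.card {i : Fin N // i ∉ D} : ℝ) := by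
  classical
  set Bd : Finset (Fin N) := Finset.univ.filter
    (fun i : Fin N => i ∈ D ∧ ∃ j : Fin N, j ∉ D ∧ dist (y i) (y j) ≤ 4 * nearestDist y i) with hBddef
  set Co : Finset (Fin N) := Finset.univ.filter (fun j : Fin N => j ∉ D) with hCodef
  have hBd : Nat.card {i : Fin N // i ∈ D ∧ ∃ j : Fin N, j ∉ D ∧ dist (y i) (y j) ≤ 4 * nearestDist y i} = Bd.card := by
    rw [hBddef, Nat.card_eq_fintype_card, Fintype.card_subtype]
  have hCo : Nat.card {i : Fin N // i ∉ D} = Co.card := by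
    rw [hCodef, Nat.card_eq_fintype_card, Fintype.card_subtype]
  have hcover : Bd ⊆ Co.biUnion
      (fun j => Finset.univ.filter (fun i : Fin N => dist (y i) (y j) ≤ 64)) := by
    intro i hi
    rw [hBddef, Finset.mem_filter] at hi
    obtain ⟨-, -, j, hjD, hj⟩ := hi
    simp only [Finset.mem_biUnion, Finset.mem_filter, Finset.mem_univ, true_and, hCodef]
    refine ⟨j, hjD, hj.trans ?_⟩
    have hnn := hreg.2 i
    linarith
  have hfib : ∀ j : Fin N,
      ((Finset.univ.filter (fun i : Fin N => dist (y i) (y j) ≤ 64)).card : ℝ) ≤ (385 : ℝ) ^ 3 := by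
    intro j
    set F : Finset (Fin N) := Finset.univ.filter (fun i : Fin N => dist (y i) (y j) ≤ 64) with hFdef
    have hcard : (F.image y).card = F.card := Finset.card_image_of_injective _ hy
    have hpack := card_le_of_separated_of_dist_le (F.image y) (y j) (r := 1 / 3) (R := 64)
      (by norm_num) (by norm_num)
      (fun c hc => by
        obtain ⟨i, hi, rfl⟩ := Finset.mem_image.1 hc
        rw [hFdef, Finset.mem_filter] at hi
        exact hi.2)
      (fun c hc d hd hcd => by
        obtain ⟨i, -, rfl⟩ := Finset.mem_image.1 hc
        obtain ⟨k, -, rfl⟩ := Finset.mem_image.1 hd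
        exact hreg.1 i k (fun h => hcd (by rw [h])))
    rw [hcard, finrank_euclideanSpace_fin] at hpack
    calc (F.card : ℝ) ≤ (2 * 64 / (1 / 3) + 1) ^ 3 := hpack
      _ = (385 : ℝ) ^ 3 := by norm_num
  have h1 : (Bd.card : ℝ) ≤ ((Co.biUnion
      (fun j => Finset.univ.filter (fun i : Fin N => dist (y i) (y j) ≤ 64))).card : ℝ) := by
    exact_mod_cast Finset.card_le_card hcover
  have h2 : ((Co.biUnion
      (fun j => Finset.univ.filter (fun i : Fin N => dist (y i) (y j) ≤ 64))).card : ℝ) ≤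
      ∑ j ∈ Co, ((Finset.univ.filter (fun i : Fin N => dist (y i) (y j) ≤ 64)).card : ℝ) := by
    exact_mod_cast Finset.card_biUnion_le
  have h3 : ∑ j ∈ Co, ((Finset.univ.filter (fun i : Fin N => dist (y i) (y j) ≤ 64)).card : ℝ)
      ≤ ∑ _j ∈ Co, (385 : ℝ) ^ 3 := Finset.sum_le_sum fun j _ => hfib j
  rw [Finset.sum_const, nsmul_eq_mul] at h3
  rw [hBd, hCo]
  linarith

/-- **STUB F — DEEP COERCIVITY, PROVED from stubs G and H** (bookkeeping; formerly a registered stub, wave-1 verdict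
`stub-blocked` ⇒ reshaped by lead c2 into G + H).  With `R = 8`: every deep site carries a Barlow chart (G) and a clean
`8·nn`-window (definition of deep), so H applies to `W = D`; an isolated band site is either a `4·nn`-interior charged site
of `D` (credited by H) or a boundary deep site, and boundary deep sites are `≤ 385³·#non-deep` (`boundaryCount_le`), the
non-deep sites being exactly the coarse plus the shallow ones (`card_not_deep`).  Constants: `c`, `C'_F = (c + max C' 0)·385³`,
`C = 0`. -/
theorem stub_deepCoercivity : ∃ R c C' C : ℝ, 1 ≤ R ∧ 0 < c ∧ 0 ≤ C' ∧ ∀ (N : ℕ) (y : Fin N → EuclideanSpace ℝ (Fin 3)), Function.Injective y → ((∀ i j : Fin N, i ≠ j → (1 / 3 : ℝ) ≤ dist (y i) (y j)) ∧ ∀ i : Fin N, Literature.Geometry.DiscreteGeometry.nearestDist y i ≤ 16) → ∀ D : Finset (Fin N), (∀ i : Fin N, i ∈ D ↔ ∀ j : Fin N, dist (y i) (y j) ≤ R * Literature.Geometry.DiscreteGeometry.nearestDist y i → Literature.Geometry.DiscreteGeometry.IsChargeFree (3 / 100 : ℝ) y j) → c * (Nat.card {i : Fin N // (∀ j : Fin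 N, dist (y i) (y j) ≤ R * Literature.Geometry.DiscreteGeometry.nearestDist y i → Literature.Geometry.DiscreteGeometry.IsChargeFree (3 / 100 : ℝ) y j) ∧ ¬ Literature.Geometry.DiscreteGeometry.IsChargeFree (1 / 100 : ℝ) y i} : ℝ) - C' * ((Nat.card {i : Fin N // ¬ Literature.Geometry.DiscreteGeometry.IsChargeFree (3 / 100 : ℝ) y i} : ℝ) + (Nat.card {i : Fin N // Literature.Geometry.DiscreteGeometry.IsChargeFree (3 / 100 : ℝ) y i ∧ ¬ ∀ j : Fin N, dist (y i) (y j) ≤ R * Literature.Geometry.DiscreteGeometry.nearestDist y i → Literature.Geometry.DiscreteGeometry.IsChargeFree (3 / 100 : ℝ) y j} : ℝ)) - C * (N : ℝ) ^ (2 / 3 : ℝ) ≤ (1 / 2 : ℝ) * (∑ i ∈ D, ∑ j ∈ D.erase i, Literature.MathematicalPhysics.StatisticalMechanics.lennardJones (dist (y i) (y j))) - (D.card : ℝ) * Summit.AtomisticToContinuum.Crystallization.Theorems.ChargedEnergyGapNegative.eStar := by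
  classical
  obtain ⟨c, hc, C', hH⟩ := barlowCoercivity_holds
  refine ⟨8, c, (c + max C' 0) * (385 : ℝ) ^ 3, 0, by norm_num, hc, by positivity, ?_⟩
  intro N y hy hreg D hD
  -- `hD` says `D` is the set of deep sites at radius 8
  have hD' : ∀ i : Fin N, i ∈ D ↔ Deep 8 y i := hD
  have hW : ∀ i ∈ D, Chart y i ∧ Deep 8 y i := fun i hi =>
    ⟨softLayerThree_holds N y i ((hD' i).1 hi), (hD' i).1 hi⟩
  have h1 := hH N y hreg.1 hreg.2 D hW
  -- cover: isolated band ⊆ interior-charged ∪ boundary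
  have hcov : (isoBandCount 8 y : ℝ) ≤
      (Nat.card {i : Fin N // i ∈ D ∧ (∀ j : Fin N, dist (y i) (y j) ≤ 4 * nearestDist y i → j ∈ D) ∧
          ¬ IsChargeFree (1 / 100 : ℝ) y i} : ℝ) +
        (Nat.card {i : Fin N // i ∈ D ∧ ∃ j : Fin N, j ∉ D ∧ dist (y i) (y j) ≤ 4 * nearestDist y i} : ℝ) := by
    have h := natCard_le_add_three (α := Fin N)
      (p := fun i => Deep 8 y i ∧ ¬ IsChargeFree (1 / 100 : ℝ) y i)
      (q := fun i => i ∈ D ∧ (∀ j : Fin N, dist (y i) (y j) ≤ 4 * nearestDist y i → j ∈ D) ∧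
          ¬ IsChargeFree (1 / 100 : ℝ) y i)
      (r := fun i => i ∈ D ∧ ∃ j : Fin N, j ∉ D ∧ dist (y i) (y j) ≤ 4 * nearestDist y i)
      (s := fun _ => False)
      (fun i hi => by
        have hiD : i ∈ D := (hD' i).2 hi.1
        by_cases hint : ∀ j : Fin N, dist (y i) (y j) ≤ 4 * nearestDist y i → j ∈ D
        · exact Or.inl ⟨hiD, hint, hi.2⟩
        · push Not at hint
          obtain ⟨j, hj, hjD⟩ := hint
          exact Or.inr (Or.inl ⟨hiD, j, hjD, hj⟩))
    have h0 : Nat.card {i : Fin N // False} = 0 := by simp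
    unfold isoBandCount
    rw [h0, add_zero] at h
    exact_mod_cast h
  -- boundary deep sites are few; non-deep = coarse + shallow
  have hbd := boundaryCount_le hy hreg D
  have hnd : (Nat.card {i : Fin N // i ∉ D} : ℝ) = (charged (3 / 100) y : ℝ) + (shallowCount 8 y : ℝ) := by
    rw [← card_not_deep (by norm_num : (0 : ℝ) ≤ 8) y]
    exact_mod_cast congrArg Nat.cast (Nat.card_congr (Equiv.subtypeEquivRight fun i => by rw [hD' i]))
  rw [hnd] at hbd
  have hGS : 0 ≤ (charged (3 / 100) y : ℝ) + (shallowCount 8 y : ℝ) := by positivity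
  have hB0 : 0 ≤ (Nat.card {i : Fin N // i ∈ D ∧ ∃ j : Fin N, j ∉ D ∧ dist (y i) (y j) ≤ 4 * nearestDist y i} : ℝ) :=
    Nat.cast_nonneg _
  have hC'le : C' ≤ max C' 0 := le_max_left _ _
  have hm0 : 0 ≤ max C' 0 := le_max_right _ _
  have key : c * (isoBandCount 8 y : ℝ) - (c + max C' 0) * (385 : ℝ) ^ 3 *
      ((charged (3 / 100) y : ℝ) + (shallowCount 8 y : ℝ)) ≤
      c * (Nat.card {i : Fin N // i ∈ D ∧ (∀ j : Fin N, dist (y i) (y j) ≤ 4 * nearestDist y i → j ∈ D) ∧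
          ¬ IsChargeFree (1 / 100 : ℝ) y i} : ℝ) -
        C' * (Nat.card {i : Fin N // i ∈ D ∧ ∃ j : Fin N, j ∉ D ∧ dist (y i) (y j) ≤ 4 * nearestDist y i} : ℝ) := by
    nlinarith [mul_le_mul_of_nonneg_left hcov hc.le, mul_le_mul_of_nonneg_left hbd (add_nonneg hc.le hm0),
      mul_le_mul_of_nonneg_right hC'le hB0]
  have hrpow : (0 : ℝ) * (N : ℝ) ^ (2 / 3 : ℝ) = 0 := zero_mul _
  unfold subEnergy2 at h1
  unfold isoBandCount charged shallowCount at key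
  unfold Deep at key
  rw [hrpow, sub_zero]
  exact key.trans h1

/-- **The deficit bound** from the restriction bookkeeping (stub E), the deep coercivity (stub F) and
`e* ≤ 0` (stub A): `E − N·e* ≥ ½ΣΣ_D V − #D·e* − B·#Dᶜ` and `#Dᶜ = #coarse + #shallow`. -/
theorem stub_deficitBound : Goal.stub_deficitBound := by
  classical
  obtain ⟨R, c, C', C, hR, hc, hC', hF⟩ :
      ∃ R c C' C : ℝ, 1 ≤ R ∧ 0 < c ∧ 0 ≤ C' ∧
        ∀ (N : ℕ) (y : Fin N → E3), Function.Injective y → Regular y → ∀ D : Finset (Fin N),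
          (∀ i : Fin N, i ∈ D ↔ Deep R y i) →
            c * (isoBandCount R y : ℝ) - C' * ((charged (3 / 100) y : ℝ) + (shallowCount R y : ℝ)) -
                C * (N : ℝ) ^ (2 / 3 : ℝ) ≤ (1 / 2 : ℝ) * subEnergy2 y D - (D.card : ℝ) * eStar :=
    stub_deepCoercivity
  obtain ⟨B, hB⟩ := deficitSplit_holds
  have he : eStar ≤ 0 := le_trans stub_eStarLe (by norm_num)
  refine ⟨R, c, C' + max B 0, C, hR, hc, by positivity, fun N y hy hreg => ?_⟩
  set D : Finset (Fin N) := Finset.univ.filter fun i : Fin N => Deep R y i with hDdef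
  have hD : ∀ i : Fin N, i ∈ D ↔ Deep R y i := fun i => by simp [hDdef]
  have h1 := hF N y hy hreg D hD
  have h2 := hB N y hreg.1 D
  have hR0 : (0 : ℝ) ≤ R := by linarith
  have h3 := card_not_deep hR0 y
  have h4 := card_deep_add y D hD
  -- `#Dᶜ` as a real
  have hDc : (N : ℝ) - (D.card : ℝ) = (charged (3 / 100) y : ℝ) + (shallowCount R y : ℝ) := by
    linarith
  rw [hDc] at h2
  have hGS : 0 ≤ (charged (3 / 100) y : ℝ) + (shallowCount R y : ℝ) := by positivity
  have h5 : B * ((charged (3 / 100) y : ℝ) + (shallowCount R y : ℝ)) ≤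
      max B 0 * ((charged (3 / 100) y : ℝ) + (shallowCount R y : ℝ)) :=
    mul_le_mul_of_nonneg_right (le_max_left _ _) hGS
  -- `−N·e* ≥ −#D·e*`
  have h6 : (N : ℝ) * eStar ≤ (D.card : ℝ) * eStar := by
    have : (D.card : ℝ) ≤ (N : ℝ) := by
      have := Finset.card_le_univ D
      rw [Fintype.card_fin] at this
      exact_mod_cast this
    nlinarith
  unfold subEnergy2 at h1 h2
  nlinarith [h1, h2, h5, h6]

/-- Sanity: where no isolated band site exists, the deficit bound (any `c`, and `C', C ≥ 0`) IS the free floor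
`N·e* ≤ E_LJ(y)` (`excess_nonneg`, unconditional in tree). -/
theorem deficitBound_of_no_isoBand {R c C' C : ℝ} (hC' : 0 ≤ C') (hC : 0 ≤ C) {N : ℕ}
    {y : Fin N → E3} (hy : Function.Injective y) (h0 : isoBandCount R y = 0) :
    c * (isoBandCount R y : ℝ) - C' * ((charged (3 / 100) y : ℝ) + (shallowCount R y : ℝ)) -
        C * (N : ℝ) ^ (2 / 3 : ℝ) ≤ interactionEnergy lennardJones y - (N : ℝ) * eStar := by
  rw [h0]
  have h1 := excess_nonneg hy
  have h2 : 0 ≤ C' * ((charged (3 / 100) y : ℝ) + (shallowCount R y : ℝ)) := by positivity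
  have h3 : 0 ≤ C * (N : ℝ) ^ (2 / 3 : ℝ) := by positivity
  push_cast
  linarith

/-! ## Shallow sites are few (sorry-free; hard-core packing) -/

/-- SHALLOW SITES ARE FEW: on regular configurations, for every window radius `R ≥ 1` the shallow sites number
at most `(96R + 1)³` times the `3 %`-charged sites — a shallow site has a `3 %`-charged site within
`R·nn_i ≤ 16R`, and a ball of radius `16R` holds at most `(96R + 1)³` points of a `1/3`-separated set
(tree `card_le_of_separated_of_dist_le`). -/
theorem shallowCount_le {R : ℝ} (hR : 1 ≤ R) {N : ℕ} {y : Fin N → E3}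
    (hy : Function.Injective y) (hreg : Regular y) :
    (shallowCount R y : ℝ) ≤ (96 * R + 1) ^ 3 * (charged (3 / 100) y : ℝ) := by
  classical
  set Sh : Finset (Fin N) :=
    Finset.univ.filter (fun i : Fin N => IsChargeFree (3 / 100 : ℝ) y i ∧ ¬ Deep R y i) with hShdef
  set Co : Finset (Fin N) :=
    Finset.univ.filter (fun j : Fin N => ¬ IsChargeFree (3 / 100 : ℝ) y j) with hCodef
  have hSh : shallowCount R y = Sh.card := by
    unfold shallowCount
    rw [hShdef, Nat.card_eq_fintype_card, Fintype.card_subtype]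
  have hCo : charged (3 / 100) y = Co.card := by
    unfold charged
    rw [hCodef, Nat.card_eq_fintype_card, Fintype.card_subtype]
  -- every shallow site lies within `16R` of a coarse site
  have hcover : Sh ⊆ Co.biUnion
      (fun j => Finset.univ.filter (fun i : Fin N => dist (y i) (y j) ≤ 16 * R)) := by
    intro i hi
    rw [hShdef, Finset.mem_filter] at hi
    obtain ⟨-, -, hnd⟩ := hi
    unfold Deep at hnd
    push Not at hnd
    obtain ⟨j, hj, hjc⟩ := hnd
    simp only [Finset.mem_biUnion, Finset.mem_filter, Finset.mem_univ, true_and, hCodef]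
    refine ⟨j, hjc, hj.trans ?_⟩
    have hnn := hreg.2 i
    have hR0 : 0 ≤ R := by linarith
    calc R * nearestDist y i ≤ R * 16 := mul_le_mul_of_nonneg_left hnn hR0
      _ = 16 * R := by ring
  -- each fibre holds at most `(96R+1)³` sites, by volume
  have hfib : ∀ j : Fin N,
      ((Finset.univ.filter (fun i : Fin N => dist (y i) (y j) ≤ 16 * R)).card : ℝ) ≤
        (96 * R + 1) ^ 3 := by
    intro j
    set F : Finset (Fin N) := Finset.univ.filter (fun i : Fin N => dist (y i) (y j) ≤ 16 * R)
      with hFdef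
    have hcard : (F.image y).card = F.card := Finset.card_image_of_injective _ hy
    have hpack := card_le_of_separated_of_dist_le (F.image y) (y j) (r := 1 / 3) (R := 16 * R)
      (by norm_num) (by linarith)
      (fun c hc => by
        obtain ⟨i, hi, rfl⟩ := Finset.mem_image.1 hc
        rw [hFdef, Finset.mem_filter] at hi
        exact hi.2)
      (fun c hc d hd hcd => by
        obtain ⟨i, -, rfl⟩ := Finset.mem_image.1 hc
        obtain ⟨k, -, rfl⟩ := Finset.mem_image.1 hd
        exact hreg.1 i k (fun h => hcd (by rw [h])))
    rw [hcard, finrank_euclideanSpace_fin] at hpack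
    calc (F.card : ℝ) ≤ (2 * (16 * R) / (1 / 3) + 1) ^ 3 := hpack
      _ = (96 * R + 1) ^ 3 := by ring
  have h1 : (Sh.card : ℝ) ≤ ((Co.biUnion
      (fun j => Finset.univ.filter (fun i : Fin N => dist (y i) (y j) ≤ 16 * R))).card : ℝ) := by
    exact_mod_cast Finset.card_le_card hcover
  have h2 : ((Co.biUnion
      (fun j => Finset.univ.filter (fun i : Fin N => dist (y i) (y j) ≤ 16 * R))).card : ℝ) ≤
      ∑ j ∈ Co, ((Finset.univ.filter (fun i : Fin N => dist (y i) (y j) ≤ 16 * R)).card : ℝ) := by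
    exact_mod_cast Finset.card_biUnion_le
  have h3 : ∑ j ∈ Co, ((Finset.univ.filter (fun i : Fin N => dist (y i) (y j) ≤ 16 * R)).card : ℝ)
      ≤ ∑ _j ∈ Co, (96 * R + 1) ^ 3 := Finset.sum_le_sum fun j _ => hfib j
  rw [Finset.sum_const, nsmul_eq_mul] at h3
  rw [hSh, hCo]
  linarith

/-! ## Bookkeeping lemmas (sorry-free) -/

/-- THE COVER `charged(1 %) ⊆ coarse ∪ shallow ∪ isolated band` (a tautology of the three predicates),
counted. -/
theorem cover_le (R : ℝ) {N : ℕ} (y : Fin N → E3) :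
    (charged (1 / 100) y : ℝ) ≤
      (charged (3 / 100) y : ℝ) + (shallowCount R y : ℝ) + (isoBandCount R y : ℝ) := by
  have h := natCard_le_add_three (α := Fin N)
    (p := fun i => ¬ IsChargeFree (1 / 100 : ℝ) y i)
    (q := fun i => ¬ IsChargeFree (3 / 100 : ℝ) y i)
    (r := fun i => IsChargeFree (3 / 100 : ℝ) y i ∧ ¬ Deep R y i)
    (s := fun i => Deep R y i ∧ ¬ IsChargeFree (1 / 100 : ℝ) y i)
    (fun i hi => by
      by_cases h3 : IsChargeFree (3 / 100 : ℝ) y i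
      · by_cases hd : Deep R y i
        · exact Or.inr (Or.inr ⟨hd, hi⟩)
        · exact Or.inr (Or.inl ⟨h3, hd⟩)
      · exact Or.inl h3)
  unfold charged shallowCount isoBandCount
  exact_mod_cast h

/-- THE WEIGHTED AVERAGE (pure real arithmetic): coarse credit `κc` per coarse site (`hA`), band credit `c` per
isolated band site with debits `C'` per coarse/shallow site (`hB`), shallow count (`hCnt`) and the cover (`hD`)
give a uniform price `κc · min(c,1) / (κc + 4M)`, `M = κc + (C'+1)(1+C₂)`, per `1 %`-charged site. -/
theorem averaging {E e P G S I ch κc c C' C₂ C₃ C₄ : ℝ}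
    (hκc : 0 < κc) (hc : 0 < c) (hC' : 0 ≤ C') (hC₂ : 0 ≤ C₂)
    (hG : 0 ≤ G) (hI : 0 ≤ I) (hP : 0 ≤ P)
    (hA : e + κc * G - C₄ * P ≤ E)
    (hB : c * I - C' * (G + S) - C₃ * P ≤ E - e)
    (hCnt : S ≤ C₂ * G) (hD : ch ≤ G + S + I) :
    e + κc * min c 1 / (κc + 4 * (κc + (C' + 1) * (1 + C₂))) * ch - (|C₃| + |C₄|) * P ≤ E := by
  obtain ⟨m, hm⟩ : ∃ m : ℝ, m = min c 1 := ⟨_, rfl⟩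
  obtain ⟨M, hM⟩ : ∃ M : ℝ, M = κc + (C' + 1) * (1 + C₂) := ⟨_, rfl⟩
  rw [← hm, ← hM]
  have hm0 : 0 < m := by rw [hm]; exact lt_min hc one_pos
  have hmc : m ≤ c := by rw [hm]; exact min_le_left _ _
  have hm1 : m ≤ 1 := by rw [hm]; exact min_le_right _ _
  have h12 : 0 ≤ 1 + C₂ := by positivity
  have hM1 : 1 + C₂ ≤ M := by
    have : (1 : ℝ) * (1 + C₂) ≤ (C' + 1) * (1 + C₂) :=
      mul_le_mul_of_nonneg_right (by linarith) h12
    linarith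
  have hM2 : C' * (1 + C₂) ≤ M := by
    have : C' * (1 + C₂) ≤ (C' + 1) * (1 + C₂) :=
      mul_le_mul_of_nonneg_right (by linarith) h12
    linarith
  have hMpos : 0 < M := by linarith
  have hDpos : 0 < κc + 4 * M := by linarith
  -- the polynomial form of the claim
  have key : κc * m * ch ≤
      (κc + 4 * M) * (E - e) + (κc + 4 * M) * ((|C₃| + |C₄|) * P) := by
    have h1 : κc * m * ch ≤ κc * m * (G + S + I) :=
      mul_le_mul_of_nonneg_left hD (by positivity)
    have h2 : κc * m * S ≤ κc * m * (C₂ * G) :=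
      mul_le_mul_of_nonneg_left hCnt (by positivity)
    have h3 : κc * m * I ≤ κc * c * I :=
      mul_le_mul_of_nonneg_right (mul_le_mul_of_nonneg_left hmc hκc.le) hI
    have h4 : κc * m * ((1 + C₂) * G) ≤ κc * M * G := by
      have hmM : m * (1 + C₂) ≤ M := le_trans (mul_le_of_le_one_left h12 hm1) hM1
      have := mul_le_mul_of_nonneg_right (mul_le_mul_of_nonneg_left hmM hκc.le) hG
      calc κc * m * ((1 + C₂) * G) = κc * (m * (1 + C₂)) * G := by ring
        _ ≤ κc * M * G := this
    have h5 : κc * (c * I - C' * (G + S) - C₃ * P) ≤ κc * (E - e) :=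
      mul_le_mul_of_nonneg_left hB hκc.le
    have h6 : 4 * M * (e + κc * G - C₄ * P) ≤ 4 * M * E :=
      mul_le_mul_of_nonneg_left hA (by positivity)
    have h7 : κc * C' * S ≤ κc * C' * (C₂ * G) :=
      mul_le_mul_of_nonneg_left hCnt (by positivity)
    have h8 : κc * (C₃ * P) ≤ κc * (|C₃| * P) :=
      mul_le_mul_of_nonneg_left (mul_le_mul_of_nonneg_right (le_abs_self C₃) hP) hκc.le
    have h9 : 4 * M * (C₄ * P) ≤ 4 * M * (|C₄| * P) :=
      mul_le_mul_of_nonneg_left (mul_le_mul_of_nonneg_right (le_abs_self C₄) hP) (by positivity)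
    have h10 : κc * (C' * (1 + C₂)) * G ≤ κc * (3 * M) * G := by
      have : C' * (1 + C₂) ≤ 3 * M := by linarith
      exact mul_le_mul_of_nonneg_right (mul_le_mul_of_nonneg_left this hκc.le) hG
    have h11 : 0 ≤ κc * (|C₄| * P) := by positivity
    have h12' : 0 ≤ 4 * M * (|C₃| * P) := by positivity
    nlinarith [h1, h2, h3, h4, h5, h6, h7, h8, h9, h10, h11, h12']
  -- divide by `κc + 4M`
  have hdiv : κc * m / (κc + 4 * M) * ch ≤ (E - e) + (|C₃| + |C₄|) * P := by
    rw [div_mul_eq_mul_div, div_le_iff₀ hDpos]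
    have : ((E - e) + (|C₃| + |C₄|) * P) * (κc + 4 * M) =
        (κc + 4 * M) * (E - e) + (κc + 4 * M) * ((|C₃| + |C₄|) * P) := by ring
    rw [this]
    exact key
  linarith

/-! ## The composition: the stubs imply the crux BY NAME -/

/-- `ChargedEnergyGap` from the registered stubs: unpack the coarse gap `(κc, C₄)` and the deficit bound
`(R, c, C', C₃)`, take the packing constant `C₂ = (96R+1)³` of `shallowCount_le`; the price per `1 %`-charged site
on regular configurations is `κc·min(c,1)/(κc + 4(κc + (C'+1)(1+C₂)))`, the allowance `|C₃| + |C₄|` (`averaging` +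
`cover_le`); the regularisation lifts it to all injective configurations. -/
theorem chargedEnergyGap_of_goals :
    Goal.stub_regularise → Goal.stub_coarseGap → Goal.stub_deficitBound → ChargedEnergyGap := by
  intro hReg hCoarse hDef
  unfold Goal.stub_regularise at hReg
  unfold Goal.stub_coarseGap at hCoarse
  unfold Goal.stub_deficitBound at hDef
  obtain ⟨κc, C₄, hκc, hA⟩ := hCoarse
  obtain ⟨R, c, C', C₃, hR, hc, hC', hB⟩ := hDef
  obtain ⟨C₂, hC₂⟩ : ∃ C₂ : ℝ, C₂ = (96 * R + 1) ^ 3 := ⟨_, rfl⟩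
  have hC₂0 : 0 ≤ C₂ := by rw [hC₂]; positivity
  refine hReg ⟨κc * min c 1 / (κc + 4 * (κc + (C' + 1) * (1 + C₂))), |C₃| + |C₄|, ?_, ?_⟩
  · have hm0 : 0 < min c 1 := lt_min hc one_pos
    have : 0 < κc + 4 * (κc + (C' + 1) * (1 + C₂)) := by positivity
    exact div_pos (mul_pos hκc hm0) this
  · intro N y hy hreg
    have hCnt : (shallowCount R y : ℝ) ≤ C₂ * (charged (3 / 100) y : ℝ) := by
      rw [hC₂]; exact shallowCount_le hR hy hreg
    exact averaging hκc hc hC' hC₂0 (Nat.cast_nonneg _) (Nat.cast_nonneg _) (by positivity)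
      (hA N y hy hreg) (hB N y hy hreg) hCnt (cover_le R y)

/-- **`two-tolerance-sandwich` — the crux BY NAME from the registered stubs.**  The kernel checks here that
the composition reaches the route decl `PricedLinkCensus.ChargedEnergyGap`; the only `sorry`s in its cone are the
registered stubs A–F. -/
theorem ChargedEnergyGap_of :
    Summit.AtomisticToContinuum.Crystallization.Theses.PricedLinkCensus.ChargedEnergyGap :=
  chargedEnergyGap_of_goals stub_regularise coarseGap_holds stub_deficitBound

end Summit.AtomisticToContinuum.Crystallization.Cruxes.ChargedEnergyGap.TwoToleranceSandwich

end
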